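import Summits.CriticalPhenomena.SAWScalingLimit.Theses.SAWTwistedSelfEnergy
import Summits.CriticalPhenomena.SAWScalingLimit.Theorems.EventualTight.Negative.TightnessNecessary

/-!
# `EventualTight` (along the mesh, stmt-CriticalPhenomena-1881) — negative knowledge: NECESSITY by name

Support file for the crux `stmt-CriticalPhenomena-1881`
(`Summit.CriticalPhenomena.SAWScalingLimit.Theses.SAWTwistedSelfEnergy.EventualTight`, the
`IsTightAlongMesh` form of eventual tightness of the critical `δℤ²` SAW laws; refuter `cdisprove`,
work file `Summits/CriticalPhenomena/SAWScalingLimit/Cruxes/EventualTight/Disproof.lean`, §6).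

* `not_sawScalingLimit_of_not_eventualTightAlongMesh :
    ¬ SAWTwistedSelfEnergy.EventualTight → ¬ SAW.SAWScalingLimit` — the along-the-mesh crux is a
  CONSEQUENCE of the summit conjunct: convergence in law to chordal SLE_κ gives a tight set of pushed
  laws on an initial mesh interval (`exists_isTightMeasureSet_image_of_convergesInLawToSLE`, the set
  form landed for the twin stmt-1372 in `TightnessNecessary.lean`), and a tight image of `(0, δ₀]`
  is tight along `𝓝[>] 0` (`isTightAlongMesh_of_isTightMeasureSet_image`, Literature). So a
  refutation of stmt-1881 refutes the Lawler–Schramm–Werner conjecture AS TYPED (every SAW route):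
  WHY the crux resists cheap disproof. Recorded by name for the negatives index / audit (the twin's
  file concludes at `SAWRenewalTightness.EventualTight` only). Everything proved, standard axioms.
  [folklore]
-/

noncomputable section

open Literature.Probability.RandomPlanarGeometry Literature.Probability.RandomPlanarGeometry.SAW
  Literature.Probability.LatticeModels MeasureTheory Filter Topology Set

namespace Summit.CriticalPhenomena.SAWScalingLimit.Theorems.EventualTight.Negative

/-- **`¬ EventualTight` (along the mesh) `→ ¬ SAWScalingLimit`**: the crux stmt-CriticalPhenomena-1881
(`SAWTwistedSelfEnergy.EventualTight`, shared verbatim by the routes SAWLaplacianWalk,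
SAWExcursionCardy, SAWAsymptoticMorera, SAWStressTensor, SAWQuadrupoleWard, SAWSchrammPassage,
SAWImaginaryGeometry, SAWTipEnvironment, …) is implied by the summit conjunct, so refuting it refutes
the LSW conjecture as typed. [folklore] -/
theorem not_sawScalingLimit_of_not_eventualTightAlongMesh
    (h : ¬ Summit.CriticalPhenomena.SAWScalingLimit.Theses.SAWTwistedSelfEnergy.EventualTight) :
    ¬ SAW.SAWScalingLimit := fun h' => h fun D a b hab => by
  obtain ⟨δ₀, hδ₀, hT⟩ := exists_isTightMeasureSet_image_of_convergesInLawToSLE hab (h' D a b hab)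
  exact isTightAlongMesh_of_isTightMeasureSet_image
    (Eventually.of_forall fun δ => (DomainSAW.measurable_of_top _).aemeasurable) hδ₀ hT

/-- Contrapositive bookkeeping in the other refuter-admissible shape: the summit conjunct and the
NEGATION of the along-the-mesh crux cannot both hold. [folklore] -/
theorem not_sawScalingLimit_and_not_eventualTightAlongMesh :
    ¬ (SAW.SAWScalingLimit ∧
      ¬ Summit.CriticalPhenomena.SAWScalingLimit.Theses.SAWTwistedSelfEnergy.EventualTight) :=
  fun h => not_sawScalingLimit_of_not_eventualTightAlongMesh h.2 h.1

end Summit.CriticalPhenomena.SAWScalingLimit.Theorems.EventualTight.Negative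

end
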